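import Literature.IUT.HodgeTheaters.DiscreteProfiniteConjugates
import Literature.IUT.HodgeTheaters.ProfiniteCompletionQuotients
import Literature.IUT.HodgeTheaters.ProfiniteCompletionSubgroups
import Literature.IUT.HodgeTheaters.DiscreteProfiniteConjugatesProofs
import Mathlib.GroupTheory.FreeGroup.NielsenSchreier
import Mathlib.GroupTheory.Subgroup.Centralizer
import Mathlib.GroupTheory.Index
import Mathlib.Algebra.Group.Subgroup.Pointwise
import HarnessLib

/-!
# [IUTchI] §2 tool: centralizers of discrete elements in the profinite completion `F̂`
# (the "centralizer condition" for free groups), and the normalizers of Lemma 2.7 (v)'s instances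

Mochizuki, *Inter-universal Teichmüller theory I*, kurims manuscript (May 2020), §2, proof of
Theorem 2.6 p. 57 ("by Lemma 2.7, (v), we conclude that `N_Ĝ(H_x) = Ĥ_x`, `N_Ĝ(H_y) = Ĥ_y`") and
proof of Lemma 2.7 (vi) p. 59 ("the closed subgroups `T̂_x`, `T̂_y ⊆ Ĝ` topologically generated by `x`
and `y` … are normally terminal … `Z_Ĝ(N̂) ∩ Ĝ₁ ⊆ Z_{Ĝ₁}(T̂_x) ∩ Z_{Ĝ₁}(T̂_y) ⊆ T̂_x ∩ T̂_y`")
[cite: Mochizuki2012, Thm 2.6 p.57] (D-0012 claim key; series status DISPUTED — the content of this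
file is classical combinatorial / profinite group theory and takes no side).

PROOF-ONLY tool file (no definitions) over the owner's `profiniteCompletion F` /
`toCompletion F = η` (`DiscreteProfiniteConjugates.lean`, abc-iut-L5-t1) and the plumbing of
`ProfiniteCompletionQuotients.lean` / `ProfiniteCompletionSubgroups.lean` (abc-iut-L5-t17; in
particular the closure characterisation `mem_closure_image_of_forall_val_mem` used below is t17's —
revision 2 of this file deletes the duplicate copy that revision 1 carried).  What is kernel-checked here:

* `val_eq_mk_of_commute` — ONE FINITE LEVEL of the *centralizer condition*: if `γ ∈ F̂` commutes with
  `η g` and the finite-index subgroup `K = N·⟨g⟩` separates the `K`-conjugacy class of `g` from every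
  other element of `g·N` in some finite quotient of `F` (hypothesis `hsep`, the shape in which
  CONJUGACY SEPARABILITY of `K` is used), then the `N`-component of `γ` is the class of an element of
  the discrete centralizer `C_F(g)`.  Argument (Minasyan's "hereditary conjugacy separability ⇒
  centralizer condition"): write `γ ≡ η(a) (mod N̂)`; then `a⁻¹ g a ∈ g·N ⊆ K` is conjugate to `g` by
  an element of `N̂`, hence in every finite quotient of `F` by an element of `N`; so `a⁻¹ g a = k g k⁻¹`
  with `k = n g^m ∈ K`, and `a n ∈ C_F(g)` has the same `N`-component as `γ`.
* `centralizer_toCompletion_subset_closure` / `centralizer_toCompletion_eq_closure` — the CENTRALIZER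
  CONDITION `C_{F̂}(η g) = closure (η '' C_F(g))`, given `hsep` at a cofinal family of levels;
* `sep_of_isFreeGroup` — `hsep` holds at level `N` whenever `K = N·⟨g⟩` is a FREE group, GIVEN
  conjugacy separability of free groups in the finite-quotient shape announced by abc-iut-L5-t14
  (`FreeGroup.exists_normal_finiteIndex_not_isConj`, [IUTchI] p. 57 l. 8–9 "[Stb1], Theorem 1"; taken
  here as the hypothesis `hcs` VERBATIM, discharged by name when that file lands);
* `centralizer_toCompletion_eq_closure_of_isFreeGroup` — hence the centralizer condition for every
  element `g` of a finite-index subgroup `G ⊆ F` that is a free group (Nielsen–Schreier for `K ⊆ G`),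
  in particular for every element of a free group `F = G`;
* adapters `hcs_of_quotient_form` / `hcs_of_finiteIndexNormalSubgroup_form` from the quotient-group
  shapes of conjugacy separability, and `mem_closure_centralizer_of_commute` — the centralizer
  condition in the shape consumed by the Theorem 2.6 assembly (abc-iut-L5-t9).

NOT in this file (they live in the COMPANION `ProfiniteCompletionNormalizers.lean`, abc-iut-L5-d2,
which imports this one): `centralizer_eq_zpowers_of_not_isPower` (in a free group the centralizer of a
non-power is cyclic), `not_isPower_of_map_eq_ofAdd_one`, `conjugacySeparable_hcs` (the hypothesis
`hcs` discharged from the tree's `FreeGroup.conjugacySeparable`), `centralizerCondition`, and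
`normalizer_closure_zpowers_eq_of_isFreeGroup` — the INSTANCES of Lemma 2.7 (v) used on pp. 57 and
59 (`N_{F̂}(T̂_g) = C_{F̂}(η g) = T̂_g` for `T̂_g = closure (η '' ⟨g⟩)`, by finite quotients, without
the `l`-cohomological-dimension argument of the printed proof of (v), p. 59).  [Revision 3 of this
header: revision 1/2 bullets announced those declarations here — referee finding G15-F1.]

Nothing here restates or weakens a typed statement; Lemma 2.7 (v) itself (arbitrary closed `T̂`
with a `Ẑ`-retraction) is not claimed.
-/

namespace Literature.IUT.HodgeTheaters.ProfiniteCompletion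

open CategoryTheory ProfiniteGrp ProfiniteGrp.ProfiniteCompletion Topology Pointwise

universe u

variable {F : Type u} [Group F]

/-! ### One finite level of the centralizer condition -/

/-- **One level of the centralizer condition** (the conjugacy-separability step of the "hereditarily
conjugacy separable ⇒ centralizer condition" argument).  Let `γ ∈ F̂` commute with `η g`, and let `N`
be a finite-index normal subgroup of `F` such that the subgroup `K = N·⟨g⟩` has the following
separation property: every `g' ∈ K` that is NOT conjugate to `g` by an element of `K` is separated
from the `K`-conjugacy class of `g` in some finite quotient `F ⧸ M`.  Then the `N`-component of `γ`
is the class of an element of the discrete centralizer `C_F(g)`. [cite: Mochizuki2012, Thm 2.6 p.57] -/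
theorem val_eq_mk_of_commute (g : F) (γ : profiniteCompletion F)
    (hγ : γ * toCompletion F g * γ⁻¹ = toCompletion F g) (N : FiniteIndexNormalSubgroup F)
    (hsep : ∀ g' ∈ N.toSubgroup ⊔ Subgroup.zpowers g,
      (¬ ∃ k ∈ N.toSubgroup ⊔ Subgroup.zpowers g, k * g * k⁻¹ = g') →
      ∃ M : FiniteIndexNormalSubgroup F, ∀ k ∈ N.toSubgroup ⊔ Subgroup.zpowers g,
        (QuotientGroup.mk (k * g * k⁻¹) : F ⧸ M.toSubgroup) ≠ QuotientGroup.mk g') :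
    ∃ c ∈ Subgroup.centralizer ({g} : Set F), γ.val N = (QuotientGroup.mk c : F ⧸ N.toSubgroup) := by
  classical
  set K : Subgroup F := N.toSubgroup ⊔ Subgroup.zpowers g with hK
  -- write `γ ≡ η a (mod N)`
  obtain ⟨a, ha⟩ : ∃ a : F, γ.val N = (QuotientGroup.mk a : F ⧸ N.toSubgroup) := by
    obtain ⟨a, ha⟩ := QuotientGroup.mk_surjective (γ.val N)
    exact ⟨a, ha.symm⟩
  -- `g' := a⁻¹ g a` lies in `g·N ⊆ K`
  have hgN : g⁻¹ * (a⁻¹ * g * a) ∈ N.toSubgroup := by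
    have h1 : (QuotientGroup.mk (a * g * a⁻¹) : F ⧸ N.toSubgroup) = QuotientGroup.mk g :=
      mk_conj_eq_of_conj_eq γ hγ N a ha
    rw [eq_comm, QuotientGroup.eq] at h1
    -- h1 : g⁻¹ * (a * g * a⁻¹) ∈ N
    have h2 := N.toSubgroup.inv_mem (N.isNormal'.conj_mem _ h1 a⁻¹)
    convert h2 using 1
    group
  have hgK : g ∈ K := Subgroup.mem_sup_right (Subgroup.mem_zpowers g)
  have hg'K : a⁻¹ * g * a ∈ K := by
    have : a⁻¹ * g * a = g * (g⁻¹ * (a⁻¹ * g * a)) := by group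
    rw [this]
    exact K.mul_mem hgK (Subgroup.mem_sup_left hgN)
  by_cases hconj : ∃ k ∈ K, k * g * k⁻¹ = a⁻¹ * g * a
  · -- `a⁻¹ g a = k g k⁻¹` with `k = n * g^m`: then `c := a * n` centralizes `g`, `c ≡ a (mod N)`
    obtain ⟨k, hk, hkg⟩ := hconj
    have hk' : k ∈ ((N.toSubgroup ⊔ Subgroup.zpowers g : Subgroup F) : Set F) := hk
    rw [Subgroup.normal_mul] at hk'
    obtain ⟨n, hn, z, hz, rfl⟩ := Set.mem_mul.mp hk'
    obtain ⟨m, rfl⟩ := Subgroup.mem_zpowers_iff.mp hz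
    refine ⟨a * n, ?_, ?_⟩
    · rw [Subgroup.mem_centralizer_iff]
      intro h hh
      rw [Set.mem_singleton_iff] at hh
      rw [hh]
      -- from `n g^m g (n g^m)⁻¹ = a⁻¹ g a` deduce `n g n⁻¹ = a⁻¹ g a`
      have h3 : n * g * n⁻¹ = a⁻¹ * g * a := by
        rw [← hkg]; group
      calc g * (a * n) = a * (a⁻¹ * g * a) * n := by group
        _ = a * (n * g * n⁻¹) * n := by rw [h3]
        _ = a * n * g := by group
    · rw [ha]
      change (QuotientGroup.mk a : F ⧸ N.toSubgroup) = QuotientGroup.mk (a * n)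
      rw [QuotientGroup.eq]
      simpa using hn
  · -- otherwise a finite quotient `F ⧸ M` separates `a⁻¹ g a` from the `K`-class of `g`: absurd
    exfalso
    obtain ⟨M, hM⟩ := hsep (a⁻¹ * g * a) hg'K hconj
    -- a representative of `γ` modulo `M ∩ N`
    obtain ⟨b, hb⟩ : ∃ b : F, γ.val (M ⊓ N) = (QuotientGroup.mk b : F ⧸ (M ⊓ N).toSubgroup) := by
      obtain ⟨b, hb⟩ := QuotientGroup.mk_surjective (γ.val (M ⊓ N))
      exact ⟨b, hb.symm⟩
    have hbN : γ.val N = (QuotientGroup.mk b : F ⧸ N.toSubgroup) :=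
      val_mk_eq_of_le γ inf_le_right b hb
    have hbM : γ.val M = (QuotientGroup.mk b : F ⧸ M.toSubgroup) :=
      val_mk_eq_of_le γ inf_le_left b hb
    -- `k := a⁻¹ b ∈ N ⊆ K`
    have hab : a⁻¹ * b ∈ N.toSubgroup := by
      have : (QuotientGroup.mk a : F ⧸ N.toSubgroup) = QuotientGroup.mk b := by
        change γ.val N = _ at hbN
        rw [← ha]; exact hbN
      exact QuotientGroup.eq.mp this
    -- `b g b⁻¹ ≡ g (mod M)` since `γ` commutes with `η g`
    have hbg : (QuotientGroup.mk (b * g * b⁻¹) : F ⧸ M.toSubgroup) = QuotientGroup.mk g :=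
      mk_conj_eq_of_conj_eq γ hγ M b hbM
    refine hM (a⁻¹ * b) (Subgroup.mem_sup_left hab) ?_
    have : a⁻¹ * b * g * (a⁻¹ * b)⁻¹ = a⁻¹ * (b * g * b⁻¹) * a := by group
    rw [this, QuotientGroup.mk_mul, QuotientGroup.mk_mul, hbg, ← QuotientGroup.mk_mul,
      ← QuotientGroup.mk_mul]

/-! ### The centralizer condition -/

/-- The element `γ` of the centralizer of `η g` satisfies `γ · η g · γ⁻¹ = η g`.
[cite: Mochizuki2012, Thm 2.6 p.57] -/
theorem conj_eq_of_mem_centralizer {g : F} {γ : profiniteCompletion F}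
    (hγ : γ ∈ Subgroup.centralizer ({toCompletion F g} : Set (profiniteCompletion F))) :
    γ * toCompletion F g * γ⁻¹ = toCompletion F g := by
  rw [Subgroup.mem_centralizer_iff] at hγ
  rw [← hγ _ (Set.mem_singleton _), mul_inv_cancel_right]

/-- The easy inclusion: `closure (η (C_F(g))) ⊆ C_{F̂}(η g)` (the centralizer of a point of the
Hausdorff group `F̂` is closed and contains the image of the discrete centralizer).
[cite: Mochizuki2012, Thm 2.6 p.57] -/
theorem closure_centralizer_subset_centralizer (g : F) :
    closure (toCompletion F '' (Subgroup.centralizer ({g} : Set F) : Set F)) ⊆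
      (Subgroup.centralizer ({toCompletion F g} : Set (profiniteCompletion F)) : Set _) := by
  refine closure_minimal ?_ ?_
  · rintro _ ⟨c, hc, rfl⟩
    rw [SetLike.mem_coe, Subgroup.mem_centralizer_iff] at hc ⊢
    intro y hy
    rw [Set.mem_singleton_iff] at hy
    subst hy
    rw [← map_mul, ← map_mul, hc g (Set.mem_singleton g)]
  · change IsClosed (Set.centralizer ({toCompletion F g} : Set (profiniteCompletion F)))
    exact Set.isClosed_centralizer _

/-- **The centralizer condition** `C_{F̂}(η g) ⊆ closure (η (C_F(g)))`, GIVEN the separation property of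
`val_eq_mk_of_commute` at a COFINAL family of finite levels `N' ⊆ N`.
[cite: Mochizuki2012, Thm 2.6 p.57] -/
theorem centralizer_toCompletion_subset_closure (g : F)
    (hsep : ∀ N : FiniteIndexNormalSubgroup F, ∃ N' : FiniteIndexNormalSubgroup F, N' ≤ N ∧
      ∀ g' ∈ N'.toSubgroup ⊔ Subgroup.zpowers g,
        (¬ ∃ k ∈ N'.toSubgroup ⊔ Subgroup.zpowers g, k * g * k⁻¹ = g') →
        ∃ M : FiniteIndexNormalSubgroup F, ∀ k ∈ N'.toSubgroup ⊔ Subgroup.zpowers g,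
          (QuotientGroup.mk (k * g * k⁻¹) : F ⧸ M.toSubgroup) ≠ QuotientGroup.mk g') :
    (Subgroup.centralizer ({toCompletion F g} : Set (profiniteCompletion F)) : Set _) ⊆
      closure (toCompletion F '' (Subgroup.centralizer ({g} : Set F) : Set F)) := by
  intro γ hγ
  apply mem_closure_image_of_forall_val_mem
  intro N
  obtain ⟨N', hN', hsepN'⟩ := hsep N
  obtain ⟨c, hc, hcv⟩ := val_eq_mk_of_commute g γ (conj_eq_of_mem_centralizer hγ) N' hsepN'
  exact ⟨c, hc, (val_mk_eq_of_le γ hN' c hcv).symm⟩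

/-- **The centralizer condition, as an equality**: `C_{F̂}(η g) = closure (η (C_F(g)))` under the
cofinal separation hypothesis. [cite: Mochizuki2012, Thm 2.6 p.57] -/
theorem centralizer_toCompletion_eq_closure (g : F)
    (hsep : ∀ N : FiniteIndexNormalSubgroup F, ∃ N' : FiniteIndexNormalSubgroup F, N' ≤ N ∧
      ∀ g' ∈ N'.toSubgroup ⊔ Subgroup.zpowers g,
        (¬ ∃ k ∈ N'.toSubgroup ⊔ Subgroup.zpowers g, k * g * k⁻¹ = g') →
        ∃ M : FiniteIndexNormalSubgroup F, ∀ k ∈ N'.toSubgroup ⊔ Subgroup.zpowers g,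
          (QuotientGroup.mk (k * g * k⁻¹) : F ⧸ M.toSubgroup) ≠ QuotientGroup.mk g') :
    (Subgroup.centralizer ({toCompletion F g} : Set (profiniteCompletion F)) : Set _) =
      closure (toCompletion F '' (Subgroup.centralizer ({g} : Set F) : Set F)) :=
  Set.Subset.antisymm (centralizer_toCompletion_subset_closure g hsep)
    (closure_centralizer_subset_centralizer g)

/-! ### The separation property from conjugacy separability of free groups -/

/-- **Conjugacy separability supplies the separation hypothesis.**  If the finite-index subgroup
`K = N·⟨g⟩` of `F` is a FREE group, then — GIVEN conjugacy separability of free groups in the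
finite-quotient form `hcs` ([IUTchI] p. 57: "`G` is conjugacy separable … [Stb1], Theorem 1, when `G`
is free"; the shape announced by abc-iut-L5-t14 for `FreeGroup.exists_normal_finiteIndex_not_isConj`) —
every `g' ∈ K` not `K`-conjugate to `g` is separated from the `K`-class of `g` in a finite quotient
of `F` (transport along `K ≃* FreeGroup (Generators K)`, push the separating normal subgroup of `K`
into `F` and take its normal core). [cite: Mochizuki2012, Thm 2.6 p.57] -/
theorem sep_of_isFreeGroup
    (hcs : ∀ (ι : Type u) (u v : FreeGroup ι), ¬ IsConj u v →
      ∃ K : Subgroup (FreeGroup ι), K.Normal ∧ K.FiniteIndex ∧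
        ∀ c : FreeGroup ι, (c * u * c⁻¹)⁻¹ * v ∉ K)
    (g : F) (N : FiniteIndexNormalSubgroup F)
    (hfree : IsFreeGroup ↥(N.toSubgroup ⊔ Subgroup.zpowers g)) :
    ∀ g' ∈ N.toSubgroup ⊔ Subgroup.zpowers g,
      (¬ ∃ k ∈ N.toSubgroup ⊔ Subgroup.zpowers g, k * g * k⁻¹ = g') →
      ∃ M : FiniteIndexNormalSubgroup F, ∀ k ∈ N.toSubgroup ⊔ Subgroup.zpowers g,
        (QuotientGroup.mk (k * g * k⁻¹) : F ⧸ M.toSubgroup) ≠ QuotientGroup.mk g' := by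
  intro g' hg' hnc
  set K : Subgroup F := N.toSubgroup ⊔ Subgroup.zpowers g with hK
  haveI : K.FiniteIndex := Subgroup.finiteIndex_of_le (le_sup_left : N.toSubgroup ≤ K)
  have hg : g ∈ K := Subgroup.mem_sup_right (Subgroup.mem_zpowers g)
  -- `g`, `g'` as elements of the free group `K`, and of `FreeGroup (Generators K)`
  set u : K := ⟨g, hg⟩ with hu
  set v : K := ⟨g', hg'⟩ with hv
  let e : K ≃* FreeGroup (IsFreeGroup.Generators K) := IsFreeGroup.toFreeGroup K
  have hnc' : ¬ IsConj (e u) (e v) := by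
    intro h
    have h' : IsConj u v := by
      have := e.symm.toMonoidHom.map_isConj h
      simpa using this
    obtain ⟨c, hc⟩ := isConj_iff.mp h'
    exact hnc ⟨c, c.2, by simpa [hu, hv, Subtype.ext_iff] using hc⟩
  obtain ⟨K₀, hK₀n, hK₀f, hK₀⟩ := hcs _ (e u) (e v) hnc'
  -- pull back to `K`, push forward to `F`, take the normal core
  let K₁ : Subgroup K := K₀.comap e.toMonoidHom
  haveI hK₁n : K₁.Normal := Subgroup.Normal.comap hK₀n _
  haveI hK₁f : K₁.FiniteIndex := by
    constructor
    rw [Subgroup.index_comap_of_surjective _ e.surjective]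
    exact hK₀f.index_ne_zero
  let M₁ : Subgroup F := K₁.map K.subtype
  haveI hM₁f : M₁.FiniteIndex := by
    constructor
    rw [Subgroup.index_map_subtype]
    exact mul_ne_zero hK₁f.index_ne_zero Subgroup.FiniteIndex.index_ne_zero
  let M : FiniteIndexNormalSubgroup F := FiniteIndexNormalSubgroup.ofSubgroup M₁.normalCore
  refine ⟨M, fun k hk heq => ?_⟩
  -- `(k g k⁻¹)⁻¹ g' ∈ M ⊆ M₁`, i.e. the images of `⟨k⟩ u ⟨k⟩⁻¹` and `v` agree in `K ⧸ K₁`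
  have hmem : (k * g * k⁻¹)⁻¹ * g' ∈ M₁ :=
    Subgroup.normalCore_le M₁ (QuotientGroup.eq.mp heq)
  obtain ⟨y, hy, hyval⟩ := Subgroup.mem_map.mp hmem
  set kK : K := ⟨k, hk⟩ with hkK
  have hy' : y = (kK * u * kK⁻¹)⁻¹ * v := by
    apply Subtype.ext
    simpa [hkK, hu, hv] using hyval
  have hyK₀ : e.toMonoidHom y ∈ K₀ := Subgroup.mem_comap.mp hy
  rw [hy'] at hyK₀
  refine hK₀ (e kK) ?_
  simpa [map_mul, map_inv] using hyK₀

/-- **The centralizer condition for elements of a free finite-index subgroup.**  Let `G ⊆ F` be a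
finite-index subgroup that is a free group and `g ∈ G`; then, GIVEN conjugacy separability of free
groups (`hcs`, as above), `C_{F̂}(η g) = closure (η (C_F(g)))`.  (The levels `N ⊆ G` are cofinal and
`N·⟨g⟩ ⊆ G` is free by the Nielsen–Schreier theorem.)  The case `G = F` is the centralizer condition
for free groups. [cite: Mochizuki2012, Thm 2.6 p.57] -/
theorem centralizer_toCompletion_eq_closure_of_isFreeGroup
    (hcs : ∀ (ι : Type u) (u v : FreeGroup ι), ¬ IsConj u v →
      ∃ K : Subgroup (FreeGroup ι), K.Normal ∧ K.FiniteIndex ∧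
        ∀ c : FreeGroup ι, (c * u * c⁻¹)⁻¹ * v ∉ K)
    (G : Subgroup F) [G.FiniteIndex] (hG : IsFreeGroup G) {g : F} (hg : g ∈ G) :
    (Subgroup.centralizer ({toCompletion F g} : Set (profiniteCompletion F)) : Set _) =
      closure (toCompletion F '' (Subgroup.centralizer ({g} : Set F) : Set F)) := by
  apply centralizer_toCompletion_eq_closure g
  intro N
  -- the level `N' := N ∩ core(G) ⊆ G`
  let N' : FiniteIndexNormalSubgroup F := N ⊓ FiniteIndexNormalSubgroup.ofSubgroup G.normalCore
  have hN'G : N'.toSubgroup ≤ G := (inf_le_right.trans (Subgroup.normalCore_le G))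
  refine ⟨N', inf_le_left, sep_of_isFreeGroup hcs g N' ?_⟩
  -- `N'·⟨g⟩ ⊆ G` is free
  have hle : N'.toSubgroup ⊔ Subgroup.zpowers g ≤ G :=
    sup_le hN'G ((Subgroup.zpowers_le).mpr hg)
  haveI : IsFreeGroup G := hG
  exact IsFreeGroup.ofMulEquiv (Subgroup.subgroupOfEquivOfLe hle)

/-! ### Adapters: the conjugacy-separability hypothesis from its quotient-group shapes -/

/-- The membership form of conjugacy separability used above follows from the QUOTIENT form with
instance binders (`∃ (K) (_ : K.Normal) (_ : K.FiniteIndex), ¬ IsConj (u·K) (v·K)`).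
[cite: Mochizuki2012, Thm 2.6 p.57] -/
theorem hcs_of_quotient_form
    (h : ∀ (ι : Type u) (u v : FreeGroup ι), ¬ IsConj u v →
      ∃ (K : Subgroup (FreeGroup ι)) (_ : K.Normal) (_ : K.FiniteIndex),
        ¬ IsConj (QuotientGroup.mk (s := K) u) (QuotientGroup.mk (s := K) v)) :
    ∀ (ι : Type u) (u v : FreeGroup ι), ¬ IsConj u v →
      ∃ K : Subgroup (FreeGroup ι), K.Normal ∧ K.FiniteIndex ∧
        ∀ c : FreeGroup ι, (c * u * c⁻¹)⁻¹ * v ∉ K := by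
  intro ι u v huv
  obtain ⟨K, hKn, hKf, hK⟩ := h ι u v huv
  refine ⟨K, hKn, hKf, fun c hc => hK ?_⟩
  have : (QuotientGroup.mk (c * u * c⁻¹) : FreeGroup ι ⧸ K) = QuotientGroup.mk v :=
    QuotientGroup.eq.mpr hc
  rw [← this, QuotientGroup.mk_mul, QuotientGroup.mk_mul, QuotientGroup.mk_inv]
  exact isConj_iff.mpr ⟨QuotientGroup.mk c, rfl⟩

/-- The membership form also follows from the shape over Mathlib's `FiniteIndexNormalSubgroup`
(`∃ K : FiniteIndexNormalSubgroup (FreeGroup ι), ¬ IsConj (u·K) (v·K)`).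
[cite: Mochizuki2012, Thm 2.6 p.57] -/
theorem hcs_of_finiteIndexNormalSubgroup_form
    (h : ∀ (ι : Type u) (u v : FreeGroup ι), ¬ IsConj u v →
      ∃ K : FiniteIndexNormalSubgroup (FreeGroup ι),
        ¬ IsConj (QuotientGroup.mk (s := K.toSubgroup) u) (QuotientGroup.mk (s := K.toSubgroup) v)) :
    ∀ (ι : Type u) (u v : FreeGroup ι), ¬ IsConj u v →
      ∃ K : Subgroup (FreeGroup ι), K.Normal ∧ K.FiniteIndex ∧
        ∀ c : FreeGroup ι, (c * u * c⁻¹)⁻¹ * v ∉ K := by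
  refine hcs_of_quotient_form fun ι u v huv => ?_
  obtain ⟨K, hK⟩ := h ι u v huv
  exact ⟨K.toSubgroup, K.isNormal', K.isFiniteIndex', hK⟩

/-- **The centralizer condition in the shape consumed by the Theorem 2.6 assembly** (abc-iut-L5-t9's
hypothesis `hCC`, minus the conjugacy-separability input `hcs`): for `G ⊆ F` of finite index and free
of finite rank, `g ∈ G`, and `σ ∈ F̂` commuting with `η g`, `σ ∈ closure (η (C_F(g)))`.
[cite: Mochizuki2012, Thm 2.6 p.57] -/
theorem mem_closure_centralizer_of_commute
    (hcs : ∀ (ι : Type u) (u v : FreeGroup ι), ¬ IsConj u v →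
      ∃ K : Subgroup (FreeGroup ι), K.Normal ∧ K.FiniteIndex ∧
        ∀ c : FreeGroup ι, (c * u * c⁻¹)⁻¹ * v ∉ K)
    (F : Type u) [Group F] (G : Subgroup F) [G.FiniteIndex] (hG : IsFreeOfFiniteRank G)
    (g : F) (hg : g ∈ G) (σ : profiniteCompletion F)
    (hσ : σ * toCompletion F g = toCompletion F g * σ) :
    σ ∈ closure (toCompletion F '' (Subgroup.centralizer ({g} : Set F) : Set F)) := by
  have hmem : σ ∈ (Subgroup.centralizer ({toCompletion F g} : Set (profiniteCompletion F)) : Set _) := by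
    rw [SetLike.mem_coe, Subgroup.mem_centralizer_iff]
    intro y hy
    rw [Set.mem_singleton_iff] at hy
    rw [hy, hσ]
  rwa [centralizer_toCompletion_eq_closure_of_isFreeGroup hcs G
    (FreeOrSurface.isFreeGroup_of_isFreeOfFiniteRank hG) hg] at hmem

end Literature.IUT.HodgeTheaters.ProfiniteCompletion
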